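/-
Origin: expansion seat `planner-pub-hodgecm-pv11-0`, handover 2026-08-18T03:28:33Z (`HOME/pub-hodgecm-pv11/lean/Pv11/EqBasic.lean`, md5 bcbed1a7, 119 lines);
landed by the gen-5 packager in gate run 18 as `HodgeCM/PerL34/EqBasic.lean` (verbatim).
-/
/-
Copyright: pub-hodgecm cell, 2026-08-18.  Seat pv11 (planner-pub-hodgecm-pv11-0), DAG node N31c.
-/
import Mathlib.Analysis.InnerProductSpace.Basic
import Mathlib.Analysis.Normed.Operator.LinearIsometry
import Mathlib.Analysis.Complex.Circle

/-!
# N31c — the two-variable basic identity `(eq:basic)` (PerL v5, proof of Lemma 4.2(b), tex ll. 563–569)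

VERBATIM TARGET (PerL v5 `paper.tex` ll. 563–569, the R3/R4 first-error repair locus):

> Consequently the Siegel–Weil section
>   `f_Φ(h,s₀) := (ω^□(h)Φ)(0)`,  `Φ := δ(φ ⊗ φ̄)`,  `s₀ = (dim V₃ − dim W_i)/2 = 1`,
> satisfies the *two-variable basic identity*
>   (eq:basic)  `f_Φ(ι(h₁,h₂),s₀) = χ_V(h₂) ⟨ω(h₁)φ, ω(h₂)φ⟩`   `(h₁,h₂ ∈ U(W_i)(𝔸))`,
> by equivariance of `δ`:
>   `ω^□(ι(h₁,h₂)) δ(φ₁ ⊗ φ̄₂) = δ( ω(h₁)φ₁ ⊗ χ_V(h₂)·\overline{ω(h₂)φ₂} )`, so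
>   `f_Φ(ι(h₁,h₂),s₀) = χ_V(h₂) (δ(ω(h₁)φ ⊗ \overline{ω(h₂)φ}))(0)`.

KIND: **L2 (honest split)**.  `(eq:basic)` is a consequence of the OUTPUT of node N31b
(doubling set-up, ll. 549–562, seat pv05), namely the two PRINT facts below, which this file takes
as *hypotheses* (left of the colon), typed exactly in the shape announced by pv05 for the shared
vocabulary `HodgeCM.PerL34.Doubling` (STATUS.md 03:25:10Z), so that the node statement over
`D : DoublingDatum` is the one-line specialisation `eq_basic D.ι D.ω D.ωbox D.ev0 D.χV D.δ
D.equivariant D.ev0_δ` once that module lands (wrapper to follow in `Pv11/EqBasicDatum.lean`).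

PRINT inputs (verbatim, with locator) — both are [GQT] = W. T. Gan, Y. Qiu, S. Takeda, *The
regularized Siegel–Weil formula (the second term identity) and the Rallis inner product formula*,
Invent. Math. 198 (2014) 739–831, doi:10.1007/s00222-014-0509-0 = arXiv:1207.4709 (v3), §11.3
"Doubling See-Saw", the two closing displays (arXiv pagination pp. 52–53; `lit read
arxiv:1207.4709` chunk p0033 L150–L170, label `[corpus:paper:arxiv-1207.4709 p33]`):

* (X₁, display 1 + the intertwiner) "By [K2] and [HKS], one knows that
  `ω_{ψ,χ_V,W_n,V_r}|_{G(U_n)×G(U_n)} = ω_{ψ,χ_V,U_n,V_r} ⊗ ( ω_{ψ,χ_V,U_n,V_r}^∨ · (χ_V ∘ det) )|_{G(U_n)×G(U_n)}`.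
  Indeed, there is an isomorphism [Li]
  `δ : ω_{ψ,χ_V,U_n,V_r} ⊗ ( ω_{ψ,χ_V,U_n,V_r}^∨ · (χ_V ∘ det) ) ⟶ ω_{ψ,χ_V,W_n,V_r}` ..."
  — unfolded on pure tensors with `ω^∨` realised on complex conjugates (`ω^∨(h)φ̄ = \overline{ω(h)φ}`,
  `ω` unitary) and `det = id` on `G(U_1) = U(W_i)` (PerL l. 558): this is hypothesis `equivariant`.
* (X₂, display 2) "... such that `δ(φ₁ ⊗ φ̄₂)(0) = ⟨φ₁, φ₂⟩` for `φ_i ∈ 𝒮(𝕏)(𝔸)`."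
  — hypothesis `ev0_δ`.  ([Li] = J.-S. Li, J. reine angew. Math. 428 (1992) 177–217, p. 182 (12);
  paywalled, acquisition request acq-07570; GQT's display is the citable published statement.)

Dictionary GQT ↔ PerL: `G(U_n) = U(W_i)` (`n = 1`), `H(V_r) = G_U = U(V₃)` (`m = 3`, Witt index
`r = 0`), `W_n = W^□ = W_i ⊕ (−W_i)`, `Y_n = W^Δ`, `Y_n^* = W^∇`, `𝒮(Y_n^* ⊗ V_r) = 𝒮((V₃ ⊗ W^∇)(𝔸))`,
`s_{m,n} = (m − d(n))/2 = (3 − 1)/2 = 1 = s₀`.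

CONVENTIONS (pv05's, copied): the paper's bracket `⟨φ₁,φ₂⟩` (linear in `φ₁`) is Mathlib's
`inner ℂ φ₂ φ₁`; `δ φ₁ φ₂` stands for `δ(φ₁ ⊗ φ̄₂)` and is linear in `φ₁`, conjugate-linear in `φ₂`
(`S →ₗ[ℂ] S →ₗ⋆[ℂ] Sbox`); `χ_V` takes values in the unit circle; `ev0` is evaluation at `0`.
Nothing in this file asserts the existence of such data: every object is a bound variable.
-/

set_option autoImplicit false

namespace HodgeCM.PerL34.EqBasic

open scoped ComplexConjugate

/-- PerL l. 564: `s₀ = (dim V₃ − dim W_i)/2 = (3 − 1)/2 = 1` (= GQT's `s_{m,n} = (m − d(n))/2`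
with `m = 3`, `d(n) = n = 1`). -/
theorem s0_eq_one : ((3 : ℚ) - 1) / 2 = 1 := by norm_num

variable {A H S Sbox : Type*} [CommGroup A] [Group H]
  [NormedAddCommGroup S] [InnerProductSpace ℂ S] [AddCommGroup Sbox] [Module ℂ Sbox]

/-- The Siegel–Weil section at `s₀` attached to `Φ ∈ 𝒮((V₃⊗W^∇)(𝔸))`, as a function on
`H(𝔸) = U(W^□)(𝔸)`: `f_Φ(h,s₀) := (ω^□(h)Φ)(0)` (PerL l. 564; pv05's `DoublingDatum.fSW`). -/
def fSW (ωbox : H →* (Sbox ≃ₗ[ℂ] Sbox)) (ev0 : Sbox →ₗ[ℂ] ℂ) (Φ : Sbox) (h : H) : ℂ :=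
  ev0 (ωbox h Φ)

/-- `Φ := δ(φ ⊗ φ̄)` (PerL l. 564; pv05's `DoublingDatum.Φ`). -/
def PhiOf (δ : S →ₗ[ℂ] S →ₗ⋆[ℂ] Sbox) (φ : S) : Sbox := δ φ φ

/-- PerL l. 569, the intermediate display: from the equivariance of `δ` (hypothesis `equivariant`
= GQT §11.3 display 1 on pure tensors, twist `χ_V` on the SECOND variable) and linearity of
evaluation at `0`,
`f_Φ(ι(h₁,h₂),s₀) = χ_V(h₂) · (δ(ω(h₁)φ ⊗ \overline{ω(h₂)φ}))(0)`. -/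
theorem fSW_iota_eq_chi_mul_ev0
    (ι : A × A →* H) (ω : A →* (S ≃ₗᵢ[ℂ] S)) (ωbox : H →* (Sbox ≃ₗ[ℂ] Sbox))
    (ev0 : Sbox →ₗ[ℂ] ℂ) (χV : A →* Circle) (δ : S →ₗ[ℂ] S →ₗ⋆[ℂ] Sbox)
    (equivariant : ∀ (h₁ h₂ : A) (φ₁ φ₂ : S),
      ωbox (ι (h₁, h₂)) (δ φ₁ φ₂) = (χV h₂ : ℂ) • δ (ω h₁ φ₁) (ω h₂ φ₂))
    (φ : S) (h₁ h₂ : A) :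
    fSW ωbox ev0 (PhiOf δ φ) (ι (h₁, h₂)) = (χV h₂ : ℂ) * ev0 (δ (ω h₁ φ) (ω h₂ φ)) := by
  unfold fSW PhiOf
  rw [equivariant, map_smul, smul_eq_mul]

/-- **N31c = PerL (eq:basic), ll. 563–567.**  For the Siegel–Weil section `f_Φ(·,s₀)`,
`Φ = δ(φ ⊗ φ̄)`, and all `h₁, h₂ ∈ U(W_i)(𝔸)`:
`f_Φ(ι(h₁,h₂),s₀) = χ_V(h₂) ⟨ω(h₁)φ, ω(h₂)φ⟩`
(paper bracket, linear in the first slot = `inner ℂ (ω h₂ φ) (ω h₁ φ)`).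
Hypotheses: `equivariant` = GQT §11.3 display 1 with the intertwiner `δ` on pure tensors (N31b output,
PRINT), `ev0_δ` = GQT §11.3 display 2 `δ(φ₁⊗φ̄₂)(0) = ⟨φ₁,φ₂⟩` (N31b output, PRINT). -/
theorem eq_basic
    (ι : A × A →* H) (ω : A →* (S ≃ₗᵢ[ℂ] S)) (ωbox : H →* (Sbox ≃ₗ[ℂ] Sbox))
    (ev0 : Sbox →ₗ[ℂ] ℂ) (χV : A →* Circle) (δ : S →ₗ[ℂ] S →ₗ⋆[ℂ] Sbox)
    (equivariant : ∀ (h₁ h₂ : A) (φ₁ φ₂ : S),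
      ωbox (ι (h₁, h₂)) (δ φ₁ φ₂) = (χV h₂ : ℂ) • δ (ω h₁ φ₁) (ω h₂ φ₂))
    (ev0_δ : ∀ (φ₁ φ₂ : S), ev0 (δ φ₁ φ₂) = inner ℂ φ₂ φ₁)
    (φ : S) (h₁ h₂ : A) :
    fSW ωbox ev0 (PhiOf δ φ) (ι (h₁, h₂)) = (χV h₂ : ℂ) * inner ℂ (ω h₂ φ) (ω h₁ φ) := by
  rw [fSW_iota_eq_chi_mul_ev0 ι ω ωbox ev0 χV δ equivariant, ev0_δ]

/-- The diagonal case `h₁ = h₂ = h` of (eq:basic): `f_Φ(ι(h,h),s₀) = χ_V(h) ‖ω(h)φ‖²`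
`= χ_V(h) ‖φ‖²` (ω unitary) — a sanity consequence, not used downstream. -/
theorem eq_basic_diag
    (ι : A × A →* H) (ω : A →* (S ≃ₗᵢ[ℂ] S)) (ωbox : H →* (Sbox ≃ₗ[ℂ] Sbox))
    (ev0 : Sbox →ₗ[ℂ] ℂ) (χV : A →* Circle) (δ : S →ₗ[ℂ] S →ₗ⋆[ℂ] Sbox)
    (equivariant : ∀ (h₁ h₂ : A) (φ₁ φ₂ : S),
      ωbox (ι (h₁, h₂)) (δ φ₁ φ₂) = (χV h₂ : ℂ) • δ (ω h₁ φ₁) (ω h₂ φ₂))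
    (ev0_δ : ∀ (φ₁ φ₂ : S), ev0 (δ φ₁ φ₂) = inner ℂ φ₂ φ₁)
    (φ : S) (h : A) :
    fSW ωbox ev0 (PhiOf δ φ) (ι (h, h)) = (χV h : ℂ) * (‖φ‖ ^ 2 : ℂ) := by
  rw [eq_basic ι ω ωbox ev0 χV δ equivariant ev0_δ, inner_self_eq_norm_sq_to_K,
    LinearIsometryEquiv.norm_map]
  rfl

end HodgeCM.PerL34.EqBasic
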